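import Summits.QuantumFields.BalabanUV.Beta.EriceRemainderEnclosureHistoryAutonomyComparisonAgeCompositionOldPairLetters

/-!
# EriceRemainderEnclosureHistoryAutonomyComparisonAgeCompositionOldPairLettersSplit — (E102b) route (N), first order: THE SPLIT K LETTER OF AN
# OLD PAIR.  In (E99a) `old_pair_letters` the younger age `j`'s reads in the older window `[m, m+k)` see the stretch `(m+j, m+k]` through the RAY
# from the pin (`h_{m+j+t} ≥ h_{m+j}√(j∕(j+t))`, tangent constant `c_a²(j+k+1) ≤ 2j`), which is sharp when the profile follows the ray (`σ² = k∕j`) and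
# poor when it is flat (`σ → 1`): the levels of the stretch are ALSO `≥ h_{m+k}` (the flow decreases).  Reading the first `T` levels by the ray
# (`c_T²(2j+T+1) ≤ 2j`, (E99a) `ray_sum_ge`) and the remaining `k − j − T` by the floor `h_{m+k}` gives, for EVERY `T ≤ k − j`,
#     (K_T)  `(2c_T(T∕j)∕σ² + 2((k−j−T)∕j + c_b)∕σ³)·x + 2c·y ≤ 1`,       `σ = h_{m+j}∕h_{m+k}`, `x = x_j(m)`, `y = x_k(m)`,
# together with `1 ≤ σ`, `σ²j ≤ k` and the J letter `2c·x + 2c_bσ²(j∕k)·y ≤ 1` of (E99a) (**`old_pair_letters_split`**; one own-window constant `c` with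
# `c²(3j+1) ≤ 2j` serves both windows).  The best `T` is `≈ j(σ² − 1)`; the sequel (E102c) chooses `T = ⌊θj⌋` per box of `σ` and certifies the wide
# pair caps by the deficit product of (E102a).  Numerics (`HOME/b2b-balaban-beta-d4-p2/g89/numerics/pair_variants.py`): LP value of {K_T, J} over `σ`
# `0.621 ∕ 0.630 ∕ 0.645 ∕ 0.659 ∕ 0.680 ∕ 0.696 ∕ 0.737` at spans `3 ∕ 4 ∕ 6 ∕ 8 ∕ 12 ∕ 16 ∕ 32` against `0.626 ∕ 0.637 ∕ 0.652 ∕ 0.673 ∕ 0.696 ∕ 0.717 ∕ 0.764`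
# for {K, J}.

Cell `pub-balaban`, β-function sub-cell, BINDER row D4 «RemainderConst leaves for Bałaban's split» (`HOME/BINDER-OWNERS.md`; owner lineage `b2b-balaban-beta-an4`;
this file by co-owner #2 lineage `b2b-balaban-beta-d4-p2`, generation 89), β-FLOW TEAM duty (1), FREEZE (0) honoured (def-free; nothing restated).

HONEST FRAMING (page 1, verbatim and binding).  *"Discharging BetaPertH makes Bałaban's UV stability UNCONDITIONAL — a real constructive-QFT result; it is
NOT the continuum limit and NOT the Clay problem."*  THIS FILE DISCHARGES NOTHING OF THE KIND.  Elementary real algebra ∕ real analysis about ABSTRACT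
functionals on a box ]0,γ]^ℕ with displayed floors, profiles and signs, and the FIRST-ORDER renewal objects of route (N) built from them — hypotheses of a
census, not facts; the form, signs, ages and moments of Bałaban's (1.22) limit functional are NOT PRINTED ([I] p. 298; GAPS G-t4-U2-1∕-2) and NOT asserted.
Row D4 class UNCHANGED (critical-path width 0; instance 0∕1; D4 DISCHARGE NO DATE).  HONEST DEPENDENCY: continuum YM on T⁴ ⇐ BetaPertH ∧ nine spine
estimates (0/9 proved); BetaPertH ⇐ (D1) ∧ (D4) ∧ CAP+tail; G-an2-4 gates asym, D1 and NE2/3/4.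

THE POINT (README `HOME/b2b-balaban-beta-d4-p2/g89/README.md` §2).  Uses (E99a) `old_pair_letters` (for `1 ≤ σ`, `σ²j ≤ k` and the J letter), `ray_sum_ge`,
(E94b) `window_sum_ge`, (E88d) `invSq_sub_ge_all_reads`, (E92b) `two_terms_le_reads`, (E79) `strictAnti_of_memFlow` BY NAME.  NOT CLAIMED: a cap (sequel);
anything printed — NOT B12 Thm 2, NOT BetaPertH, NOT continuum, NOT Clay.

WHAT IS PROVED ([folklore]; 0 `def`, 0 sorry).  §1 `own_const_mono`, **`old_pair_letters_split`**.
-/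
noncomputable section
open Finset

namespace Summit.QuantumFields.BalabanUV.Beta.EriceRemainderEnclosureHistoryAutonomyComparisonAgeCompositionOldPairLettersSplit

open Literature.MathematicalPhysics.QuantumFieldTheory.Balaban1983to89
open Literature.MathematicalPhysics.QuantumFieldTheory.Balaban1983to89.T4BetaStationary
open Literature.MathematicalPhysics.QuantumFieldTheory.Balaban1983to89.T4BetaFlowWellPosed
open Summit.QuantumFields.BalabanUV.Beta.EriceRemainderEnclosureHistoryAutonomyOrder (strictAnti_of_memFlow)
open Summit.QuantumFields.BalabanUV.Beta.EriceRemainderEnclosureHistoryAutonomyComparisonAgeCompositionThreeAgesFlowReads (invSq_sub_ge_all_reads)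
open Summit.QuantumFields.BalabanUV.Beta.EriceRemainderEnclosureHistoryAutonomyComparisonAgeCompositionPairShares (two_terms_le_reads)
open Summit.QuantumFields.BalabanUV.Beta.EriceRemainderEnclosureHistoryAutonomyComparisonAgeCompositionYoungPairMoment (window_sum_ge)
open Summit.QuantumFields.BalabanUV.Beta.EriceRemainderEnclosureHistoryAutonomyComparisonAgeCompositionOldPairLetters (ray_sum_ge old_pair_letters)

variable {B : (ℕ → ℝ) → ℝ} {γ b gIR : ℝ} {L : ℕ → ℝ} {K : ℕ} {h : ℕ → ℝ}

/-! ## §1 The split K letter -/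

/-- The own-window tangent constant is monotone in the age: `c²(3j+1) ≤ 2j` and `j ≤ k` give `c²(3k+1) ≤ 2k` (since `c² ≤ 2∕3`). [folklore] -/
theorem own_const_mono {c : ℝ} {j k : ℕ} (hj : 1 ≤ j) (hjk : j ≤ k) (hc : c ^ 2 * (3 * (j : ℝ) + 1) ≤ 2 * j) :
    c ^ 2 * (3 * (k : ℝ) + 1) ≤ 2 * k := by
  have hjr : (1 : ℝ) ≤ j := by exact_mod_cast hj
  have hjkr : (j : ℝ) ≤ k := by exact_mod_cast hjk
  have hc2 : 3 * c ^ 2 ≤ 2 := by nlinarith [sq_nonneg c]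
  nlinarith [sq_nonneg c]

/-- **THE SPLIT K LETTER OF AN OLD PAIR.**  Ages `1 ≤ j < k < K` loaded (`L ≥ 0`), a split length `T` with `T + j ≤ k`, constants `c²(3j+1) ≤ 2j` (own
windows), `c_T²(2j+T+1) ≤ 2j` (the first `T` levels of the stretch under the ray through `m+j`), `c_b²(2k+j+1) ≤ 2k` (the far window under the ray
through `m+k`); `σ = h_{m+j}∕h_{m+k}`, `x = j·L_jh_{m+j}³∕2`, `y = k·L_kh_{m+k}³∕2`.  Then `1 ≤ σ`, `σ²·j ≤ k`, the SPLIT LETTER K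
`(2c_T(T∕j)∕σ² + 2((k−j−T)∕j + c_b)∕σ³)·x + 2c·y ≤ 1` (the `k−j−T` last levels of the stretch are `≥ h_{m+k}`: the flow decreases) and the LETTER J
`2c·x + 2c_bσ²(j∕k)·y ≤ 1` ((E99a)). [folklore] -/
theorem old_pair_letters_split (hmono : ∀ u v : ℕ → ℝ, SeqBox γ u → SeqBox γ v → (∀ j, u j ≤ v j) → B u ≤ B v)
    (hL : ∀ k, 0 ≤ L k) (hb : 0 < b) (hlo : ∀ u, SeqBox γ u → b ≤ B u) (hdom : ∀ u, SeqBox γ u → ∑ k ∈ range K, L k * u k ≤ B u)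
    (hh : SeqBox γ h) (hf : MemFlow B gIR h) {j k T : ℕ} (hj : 1 ≤ j) (hjk : j < k) (hkK : k < K) (hT : T + j ≤ k) {c cT cb : ℝ}
    (hc : c ^ 2 * (3 * (j : ℝ) + 1) ≤ 2 * j) (hcT : cT ^ 2 * (2 * (j : ℝ) + T + 1) ≤ 2 * j) (hcb : cb ^ 2 * (2 * (k : ℝ) + j + 1) ≤ 2 * k) (m : ℕ) :
    1 ≤ h (m + j) / h (m + k) ∧ (h (m + j) / h (m + k)) ^ 2 * j ≤ k
    ∧ (2 * cT * ((T : ℝ) / j) / (h (m + j) / h (m + k)) ^ 2 + 2 * (((k : ℝ) - j - T) / j + cb) / (h (m + j) / h (m + k)) ^ 3)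
        * ((j : ℝ) * (L j * h (m + j) ^ 3 / 2)) + 2 * c * ((k : ℝ) * (L k * h (m + k) ^ 3 / 2)) ≤ 1
    ∧ 2 * c * ((j : ℝ) * (L j * h (m + j) ^ 3 / 2))
        + 2 * cb * (h (m + j) / h (m + k)) ^ 2 * ((j : ℝ) / k) * ((k : ℝ) * (L k * h (m + k) ^ 3 / 2)) ≤ 1 := by
  have hpos : ∀ n, 0 < h n := fun n => (hh n).1
  have hanti := (strictAnti_of_memFlow hb hlo hh hf).antitone
  have hjK : j < K := lt_trans hjk hkK
  have hk1 : 1 ≤ k := by omega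
  have hmj := hpos (m + j); have hmk := hpos (m + k)
  have hLj := hL j; have hLk := hL k
  have hcK : c ^ 2 * (3 * (k : ℝ) + 1) ≤ 2 * k := own_const_mono hj hjk.le hc
  -- (E99a) for σ and the J letter (its stretch constant is not needed: take `ca = 0`)
  obtain ⟨hσ1, hσ2, -, hJ⟩ := old_pair_letters hmono hL hb hlo hdom hh hf hj hjk hkK (cK := c) (cJ := c) (ca := 0) (cb := cb)
    hcK hc (by rw [zero_pow two_ne_zero, zero_mul]; positivity) hcb m
  refine ⟨hσ1, hσ2, ?_, hJ⟩
  -- the three ray ∕ floor sums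
  obtain ⟨n₂, hn₂⟩ : ∃ n₂ : ℕ, k = T + n₂ + j := ⟨k - j - T, by omega⟩
  have hn₂r : (n₂ : ℝ) = (k : ℝ) - j - T := by
    have : (k : ℝ) = (T : ℝ) + n₂ + j := by exact_mod_cast hn₂
    linarith
  have hWk : c * k * h (m + k) ≤ ∑ q ∈ range k, h (m + k + 1 + q) := window_sum_ge hmono hb hlo hh hf hk1 hcK m
  have hRT : cT * T * h (m + j) ≤ ∑ q ∈ range T, h (m + j + 1 + q) := ray_sum_ge hmono hb hlo hh hf hj T hcT m
  have hFl : (n₂ : ℝ) * h (m + k) ≤ ∑ q ∈ range n₂, h (m + j + 1 + T + q) := by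
    have : ∑ q ∈ range n₂, h (m + k) ≤ ∑ q ∈ range n₂, h (m + j + 1 + T + q) :=
      sum_le_sum fun q hq => hanti (by have := mem_range.mp hq; omega)
    rwa [sum_const, card_range, nsmul_eq_mul] at this
  have hRb : cb * j * h (m + k) ≤ ∑ q ∈ range j, h (m + k + 1 + q) := ray_sum_ge hmono hb hlo hh hf hk1 j hcb m
  -- LETTER K_T: the k reads over [m, m+k) are below the rise 1∕h_{m+k}²
  have hwin : ∑ q ∈ range k, (L j * h (m + q + 1 + j) + L k * h (m + q + 1 + k)) ≤ 1 / h (m + k) ^ 2 := by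
    have e1 := invSq_sub_ge_all_reads hdom hh hf m k
    have e2 : ∑ q ∈ range k, (L j * h (m + q + 1 + j) + L k * h (m + q + 1 + k))
        ≤ ∑ q ∈ range k, ∑ i ∈ range K, L i * h (m + q + 1 + i) :=
      sum_le_sum fun q _ => two_terms_le_reads hL hh (ne_of_lt hjk) hjK hkK (m + q + 1)
    have e3 : 0 < 1 / h m ^ 2 := by have := hpos m; positivity
    linarith
  rw [sum_add_distrib] at hwin
  have hKk : L k * (c * k * h (m + k)) ≤ ∑ q ∈ range k, L k * h (m + q + 1 + k) := by
    rw [← mul_sum]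
    refine mul_le_mul_of_nonneg_left (hWk.trans_eq (sum_congr rfl fun q _ => ?_)) hLk
    rw [show m + k + 1 + q = m + q + 1 + k by ring]
  have hKj : L j * (cT * T * h (m + j) + ((n₂ : ℝ) + cb * j) * h (m + k)) ≤ ∑ q ∈ range k, L j * h (m + q + 1 + j) := by
    have hsplit : ∑ q ∈ range k, h (m + q + 1 + j)
        = ∑ q ∈ range T, h (m + j + 1 + q) + ∑ q ∈ range n₂, h (m + j + 1 + T + q) + ∑ q ∈ range j, h (m + k + 1 + q) := by
      conv_lhs => rw [hn₂]
      rw [sum_range_add, sum_range_add]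
      congr 1
      · congr 1
        · exact sum_congr rfl fun q _ => by rw [show m + q + 1 + j = m + j + 1 + q by ring]
        · exact sum_congr rfl fun q _ => by rw [show m + (T + q) + 1 + j = m + j + 1 + T + q by ring]
      · exact sum_congr rfl fun q _ => by rw [show m + (T + n₂ + q) + 1 + j = m + k + 1 + q by omega]
    rw [← mul_sum, hsplit]
    refine mul_le_mul_of_nonneg_left ?_ hLj
    have : ((n₂ : ℝ) + cb * j) * h (m + k) = (n₂ : ℝ) * h (m + k) + cb * j * h (m + k) := by ring
    linarith [hRT, hFl, hRb]
  have hsum : L k * (c * k * h (m + k)) + L j * (cT * T * h (m + j) + ((n₂ : ℝ) + cb * j) * h (m + k)) ≤ 1 / h (m + k) ^ 2 := by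
    linarith
  have key := mul_le_mul_of_nonneg_left hsum (sq_nonneg (h (m + k)))
  have e1 : h (m + k) ^ 2 * (1 / h (m + k) ^ 2) = 1 := by field_simp
  have e2 : h (m + k) ^ 2 * (L k * (c * k * h (m + k)) + L j * (cT * T * h (m + j) + ((n₂ : ℝ) + cb * j) * h (m + k)))
      = (2 * cT * ((T : ℝ) / j) / (h (m + j) / h (m + k)) ^ 2 + 2 * (((k : ℝ) - j - T) / j + cb) / (h (m + j) / h (m + k)) ^ 3)
          * ((j : ℝ) * (L j * h (m + j) ^ 3 / 2)) + 2 * c * ((k : ℝ) * (L k * h (m + k) ^ 3 / 2)) := by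
    rw [hn₂r]
    field_simp
    ring
  rw [e1, e2] at key
  exact key

end Summit.QuantumFields.BalabanUV.Beta.EriceRemainderEnclosureHistoryAutonomyComparisonAgeCompositionOldPairLettersSplit
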